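import Literature.Probability.RandomPlanarGeometry.LoopConfigurations
import Mathlib.Probability.Kernel.Disintegration.StandardBorel
import Mathlib.Probability.Kernel.Composition.Lemmas
import HarnessLib

/-!
# DKKMO's `d_CN` as a metric: isometry invariance and the triangle inequality for laws

Fourth step (after `UnbasedLoops`, `UnbasedLoopSpace`, `LoopConfigurations`) of the paper-form
("as printed") objects of Duminil-Copin–Kozlowski–Krachun–Manolescu–Oulamara, *Rotational
invariance in critical planar lattice models*, arXiv:2012.11672v2 (2026), §1.2. It supplies the
two structural properties of the printed distance `d_CN` (eq. (1)–(2)) that the reduction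
"Theorem 1.7 ⇒ Theorem 1.2" of Remark 1.8 uses (`Literature.Probability.Percolation.
LoopRepresentationProofs`):

* **isometry invariance** — a plane isometry fixing the origin acts on unbased loops, on typed
  configurations, and leaves the relation `d_CN(F, F') ≤ ε` invariant (it preserves the distance
  `d` of eq. (1), the types and the soft window `B(0, 1/ε)`);
* **the triangle inequality for the coupling distance of eq. (2)** —
  `d_CN(φ, φ'') ≤ d_CN(φ, φ') + d_CN(φ', φ'')` for probability laws, by *gluing* two couplings
  along the common marginal (disintegration; Mathlib's `Measure.condKernel` on standard Borel
  spaces) and the restricted triangle inequality `IsClose.trans` below scale `1` (all coupling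
  distances of probability laws are `≤ 1`). This is the coupling surgery of DKKMO's proof of
  Theorem 1.2 (v1 §7.1; v2 Remark 1.8 / §4.1: "couple `σ_0 ω'` with `ω^α` […], then couple
  `σ_{α/2} ω^α` with `ω`").

## Contents

* `Curve.map_shift`, `Curve.loopDist_map_map_of_isometry`, `BasedLoop.map`, `UnbasedLoop.map`
  (push-forward along an isometry; `dist_map_map`, `reverse_map`, `udist_map_map`, `range_map`),
  `LoopConfig.map`, `LoopConfig.isClose_map_iff` (invariance of `d_CN ≤ ε` under isometries
  fixing `0`), `LoopConfig.isClose_congr_of_reverse_mem` / `isClose_map_reverse_congr`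
  (configurations differing by reversing members are interchangeable).
* `LoopConfig.isClose_iff_of_gen`, `LoopConfig.measurableSet_isClose_of_gen`: for *countably
  generated* random configurations (`(X ω).F i = {f i k | ω ∈ S i k}`, `k` in a countable index
  type, `S i k` measurable — the shape of every lattice loop representation) the event
  `{d_CN(X, X') ≤ ε}` is measurable on `Ω × Ω'`; `gen_map`, `gen_comp`.
* `LoopConfig.cnLawEDist_le_one`, `cnLawEDist_self`, `cnLawEDist_congr`, `cnLawEDist_map_le`
  (transport of couplings along measurable maps), `exists_glued_coupling` (gluing lemma),
  `cnLawEDist_triangle`.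

Only isometries are needed (rotations and reflections of `ℂ`), so `UnbasedLoop.map` is defined
for isometries; general continuous maps would require the uniform-continuity argument of
`Curve.dist_map_map_eq_zero` for `loopDist` and are deliberately not treated.

## References

* H. Duminil-Copin, K. K. Kozlowski, D. Krachun, I. Manolescu, M. Oulamara, arXiv:2012.11672v2
  (2026), §1.2 (eq. (1), (2)), Remark 1.8, §4.1; v1 (2020), §7.1 (the coupling surgery).
* C. Villani, *Optimal Transport, Old and New* (2009), Ch. 1, Gluing Lemma.
* R. M. Dudley, *Real Analysis and Probability* (2002), §10.2 (disintegration), §11.8.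
-/

noncomputable section

open Set MeasureTheory ProbabilityTheory
open scoped unitInterval ENNReal

namespace Literature.Probability.RandomPlanarGeometry

/-! ### Push-forward of loops along isometries -/

namespace Curve

variable {E F : Type*} [MetricSpace E] [MetricSpace F]

/-- A curve is a loop iff its image under an injective continuous map is. [folklore] -/
theorem isLoop_map_iff {f : C(E, F)} (hf : Function.Injective f) (γ : Curve E) :
    (γ.map f).IsLoop ↔ γ.IsLoop := by
  simp only [Curve.isLoop_iff, source_def, target_def, map_apply]
  exact hf.eq_iff

/-- Push-forward commutes with the change of base point of a loop. [folklore] -/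
theorem map_shift {f : C(E, F)} (hf : Function.Injective f) (γ : Curve E) (a : ℝ) :
    (γ.map f).shift a = (γ.shift a).map f := by
  by_cases hγ : γ.IsLoop
  · have hγ' : (γ.map f).IsLoop := (isLoop_map_iff hf γ).2 hγ
    apply DFunLike.coe_injective
    funext t
    rw [shift_apply hγ', map_apply, shift_apply hγ, loopMap_coe_eq, loopMap_coe_eq, map_apply]
  · rw [shift_of_not_isLoop hγ, shift_of_not_isLoop (mt (isLoop_map_iff hf γ).1 hγ)]

/-- **Push-forward along an isometry preserves the unbased oriented distance** `loopDist`. [folklore] -/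
theorem loopDist_map_map_of_isometry {f : C(E, F)} (hf : Isometry f) (α β : Curve E) :
    loopDist (α.map f) (β.map f) = loopDist α β := by
  simp only [loopDist, map_shift hf.injective, ← dist_def, dist_map_map_of_isometry hf]

end Curve

namespace CurveClass

variable {E F : Type*} [MetricSpace E] [MetricSpace F]

/-- Push-forward along an isometry preserves `CurveClass.loopDist`. [folklore] -/
theorem loopDist_map_map_of_isometry {f : C(E, F)} (hf : Isometry f) (c₁ c₂ : CurveClass E) :
    loopDist (c₁.map f) (c₂.map f) = loopDist c₁ c₂ := by
  obtain ⟨α, rfl⟩ := surjective_mk c₁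
  obtain ⟨β, rfl⟩ := surjective_mk c₂
  simp [Curve.loopDist_map_map_of_isometry hf]

end CurveClass

namespace BasedLoop

variable {E F G : Type*} [MetricSpace E] [MetricSpace F] [MetricSpace G]

/-- Push-forward of a based loop along a continuous map. [folklore] -/
def map (f : C(E, F)) (ℓ : BasedLoop E) : BasedLoop F := mk (ℓ.toCurveClass.map f) (ℓ.isLoop.map f)

/-- The class of the pushed-forward based loop. [folklore] -/
@[simp] theorem toCurveClass_map (f : C(E, F)) (ℓ : BasedLoop E) :
    (ℓ.map f).toCurveClass = ℓ.toCurveClass.map f := rfl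

/-- `map` on `BasedLoop.mk`. [folklore] -/
@[simp] theorem map_mk (f : C(E, F)) (c : CurveClass E) (hc : c.IsLoop) :
    (mk c hc).map f = mk (c.map f) (hc.map f) := rfl

/-- Two based loops are equal iff their curve classes are. [folklore] -/
theorem mk_eq_mk {c c' : CurveClass E} {hc : c.IsLoop} {hc' : c'.IsLoop} : mk c hc = mk c' hc' ↔ c = c' :=
  ⟨fun h ↦ congrArg toCurveClass h, fun h ↦ by subst h; rfl⟩

/-- Push-forward of based loops along an isometry is an isometry of the unbased distance. [folklore] -/
theorem dist_map_map {f : C(E, F)} (hf : Isometry f) (ℓ ℓ' : BasedLoop E) :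
    dist (ℓ.map f) (ℓ'.map f) = dist ℓ ℓ' :=
  CurveClass.loopDist_map_map_of_isometry hf _ _

/-- Push-forward commutes with time reversal. [folklore] -/
theorem reverse_map (f : C(E, F)) (ℓ : BasedLoop E) : (ℓ.map f).reverse = ℓ.reverse.map f :=
  Subtype.ext (CurveClass.reverse_map f ℓ.toCurveClass)

/-- Functoriality of push-forward. [folklore] -/
theorem map_map (f : C(E, F)) (g : C(F, G)) (ℓ : BasedLoop E) :
    (ℓ.map f).map g = ℓ.map (g.comp f) :=
  Subtype.ext (CurveClass.map_map f g ℓ.toCurveClass)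

/-- Push-forward along the identity. [folklore] -/
@[simp] theorem map_id (ℓ : BasedLoop E) : ℓ.map (ContinuousMap.id E) = ℓ :=
  Subtype.ext (CurveClass.map_id ℓ.toCurveClass)

end BasedLoop

namespace UnbasedLoop

variable {E F G : Type*} [MetricSpace E] [MetricSpace F] [MetricSpace G]

/-- **Push-forward of an unbased loop along an isometry** (well defined: an isometry of the
plane induces an isometry of the unbased distance, `BasedLoop.dist_map_map`). Only isometries
are needed here (rotations and reflections of `ℂ`); general continuous maps would require the
uniform-continuity argument of `Curve.dist_map_map_eq_zero` for `loopDist`. [folklore] -/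
def map (f : C(E, F)) (hf : Isometry f) : UnbasedLoop E → UnbasedLoop F :=
  SeparationQuotient.lift (mk ∘ BasedLoop.map f) fun a b h ↦ by
    simp only [Function.comp_apply, mk_eq_mk, BasedLoop.dist_map_map hf]
    exact Metric.inseparable_iff.1 h

/-- `map` on the unbased loop of a based loop. [folklore] -/
@[simp] theorem map_mk {f : C(E, F)} (hf : Isometry f) (ℓ : BasedLoop E) :
    (mk ℓ).map f hf = mk (ℓ.map f) := rfl

/-- Push-forward along an isometry is an isometry of unbased loops. [folklore] -/
@[simp] theorem dist_map_map {f : C(E, F)} (hf : Isometry f) (u v : UnbasedLoop E) :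
    dist (u.map f hf) (v.map f hf) = dist u v := by
  obtain ⟨ℓ, rfl⟩ := mk_surjective u
  obtain ⟨ℓ', rfl⟩ := mk_surjective v
  simp [BasedLoop.dist_map_map hf]

/-- Push-forward commutes with time reversal. [folklore] -/
theorem reverse_map {f : C(E, F)} (hf : Isometry f) (u : UnbasedLoop E) :
    (u.map f hf).reverse = u.reverse.map f hf := by
  obtain ⟨ℓ, rfl⟩ := mk_surjective u
  simp [BasedLoop.reverse_map]

/-- Push-forward along an isometry preserves DKKMO's distance `d` (eq. (1)). [folklore] -/
@[simp] theorem udist_map_map {f : C(E, F)} (hf : Isometry f) (u v : UnbasedLoop E) :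
    (u.map f hf).udist (v.map f hf) = u.udist v := by
  rw [udist_def, udist_def, reverse_map, dist_map_map, dist_map_map]

/-- The trace of the pushed-forward loop is the image of the trace. [folklore] -/
@[simp] theorem range_map {f : C(E, F)} (hf : Isometry f) (u : UnbasedLoop E) :
    (u.map f hf).range = f '' u.range := by
  obtain ⟨ℓ, rfl⟩ := mk_surjective u
  simp

/-- Functoriality of push-forward. [folklore] -/
theorem map_map {f : C(E, F)} (hf : Isometry f) {g : C(F, G)} (hg : Isometry g) (u : UnbasedLoop E) :
    (u.map f hf).map g hg = u.map (g.comp f) (hg.comp hf) := by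
  obtain ⟨ℓ, rfl⟩ := mk_surjective u
  simp [BasedLoop.map_map]

/-- Push-forward along the identity. [folklore] -/
@[simp] theorem map_id (u : UnbasedLoop E) : u.map (ContinuousMap.id E) isometry_id = u := by
  obtain ⟨ℓ, rfl⟩ := mk_surjective u
  simp

end UnbasedLoop

/-! ### Push-forward of typed configurations; invariance of `d_CN ≤ ε` under isometries fixing `0` -/

namespace LoopConfig

section Map

variable {E F G : Type*} [MetricSpace E] [MetricSpace F] [MetricSpace G]

/-- Push-forward of a typed loop configuration along an isometry (types are kept). [folklore] -/
def map (f : C(E, F)) (hf : Isometry f) (c : LoopConfig E) : LoopConfig F where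
  F i := UnbasedLoop.map f hf '' c.F i

/-- Membership in a pushed-forward configuration. [folklore] -/
@[simp] theorem mem_map_iff {f : C(E, F)} (hf : Isometry f) {c : LoopConfig E} {i : Fin 2}
    {u : UnbasedLoop F} : u ∈ (c.map f hf).F i ↔ ∃ v ∈ c.F i, v.map f hf = u := Iff.rfl

/-- Functoriality of push-forward of configurations. [folklore] -/
theorem map_map {f : C(E, F)} (hf : Isometry f) {g : C(F, G)} (hg : Isometry g) (c : LoopConfig E) :
    (c.map f hf).map g hg = c.map (g.comp f) (hg.comp hf) := by
  ext i u
  simp only [mem_map_iff, exists_exists_and_eq_and, UnbasedLoop.map_map]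

/-- Push-forward along the identity. [folklore] -/
@[simp] theorem map_id (c : LoopConfig E) : c.map (ContinuousMap.id E) isometry_id = c := by
  ext i u
  simp

/-- Push-forward only depends on the map (bookkeeping for the isometry witness). [folklore] -/
theorem map_congr {f g : C(E, F)} (h : f = g) (hf : Isometry f) (hg : Isometry g) (c : LoopConfig E) :
    c.map f hf = c.map g hg := by
  subst h
  rfl

/-- If `c₁` is `c₂` with all members reversed, the same holds after push-forward (push-forward
commutes with reversal). [folklore] -/
theorem mem_map_iff_reverse_mem_map {c₁ c₂ : LoopConfig E}
    (h : ∀ i u, u ∈ c₁.F i ↔ u.reverse ∈ c₂.F i) (f : C(E, F)) (hf : Isometry f) :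
    ∀ i u, u ∈ (c₁.map f hf).F i ↔ u.reverse ∈ (c₂.map f hf).F i := by
  intro i u
  simp only [mem_map_iff]
  constructor
  · rintro ⟨v, hv, rfl⟩
    exact ⟨v.reverse, (h i v).1 hv, by rw [← UnbasedLoop.reverse_map]⟩
  · rintro ⟨w, hw, hwu⟩
    refine ⟨w.reverse, (h i w.reverse).2 (by rwa [UnbasedLoop.reverse_reverse]), ?_⟩
    rw [← UnbasedLoop.reverse_map, hwu, UnbasedLoop.reverse_reverse]

end Map

section Reverse

variable {E : Type*} [NormedAddCommGroup E]

/-- **`d_CN ≤ ε` does not see the orientation of the members**: if `c₁` is `c₂` with all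
members reversed then `d_CN(c₁, c') ≤ ε ↔ d_CN(c₂, c') ≤ ε`
(`IsClose.of_forall_mem_or_reverse_mem`). [folklore] -/
theorem isClose_congr_of_reverse_mem {c₁ c₂ c' : LoopConfig E}
    (h : ∀ i u, u ∈ c₁.F i ↔ u.reverse ∈ c₂.F i) {ε : ℝ} : IsClose ε c₁ c' ↔ IsClose ε c₂ c' := by
  have h₁ : ∀ i, ∀ u ∈ c₁.F i, u ∈ c₂.F i ∨ u.reverse ∈ c₂.F i := fun i u hu ↦ Or.inr ((h i u).1 hu)
  have h₂ : ∀ i, ∀ u ∈ c₂.F i, u ∈ c₁.F i ∨ u.reverse ∈ c₁.F i := fun i u hu ↦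
    Or.inr ((h i u.reverse).2 (by rwa [UnbasedLoop.reverse_reverse]))
  exact ⟨fun hc ↦ hc.of_forall_mem_or_reverse_mem h₂ h₁, fun hc ↦ hc.of_forall_mem_or_reverse_mem h₁ h₂⟩

/-- Push-forward form of `isClose_congr_of_reverse_mem`: if `c₁` is `c₂` with all members
reversed then `d_CN(f c₁, c') ≤ ε ↔ d_CN(f c₂, c') ≤ ε` for an isometry `f`. [folklore] -/
theorem isClose_map_reverse_congr {F : Type*} [NormedAddCommGroup F] {f : C(E, F)} (hf : Isometry f)
    {c₁ c₂ : LoopConfig E} (h : ∀ i u, u ∈ c₁.F i ↔ u.reverse ∈ c₂.F i) {ε : ℝ} {c' : LoopConfig F} :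
    IsClose ε (c₁.map f hf) c' ↔ IsClose ε (c₂.map f hf) c' :=
  isClose_congr_of_reverse_mem (mem_map_iff_reverse_mem_map h f hf)

end Reverse

section Normed

variable {E F : Type*} [NormedAddCommGroup E] [NormedAddCommGroup F]

/-- An isometry fixing the origin pulls the window `B(0, r)` back to the window `B(0, r)`. [folklore] -/
theorem preimage_ball_zero {f : C(E, F)} (hf : Isometry f) (h0 : f 0 = 0) (r : ℝ) :
    f ⁻¹' Metric.ball (0 : F) r = Metric.ball (0 : E) r := by
  ext x
  simp only [Set.mem_preimage, Metric.mem_ball]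
  rw [← h0, hf.dist_eq]

/-- **`d_CN ≤ ε` is invariant under isometries fixing the origin** (applied to both
configurations): push-forward preserves the types, the distance `d` of eq. (1)
(`UnbasedLoop.udist_map_map`) and the soft window `B(0, 1/ε)` (`preimage_ball_zero`).
(DKKMO, arXiv:2012.11672v2, §4.1: `d_CN(ω, σ ω') = d_CN(σ ω, ω')` for a reflection `σ`.) [folklore] -/
theorem isClose_map_iff {f : C(E, F)} (hf : Isometry f) (h0 : f 0 = 0) {ε : ℝ} {c c' : LoopConfig E} :
    IsClose ε (c.map f hf) (c'.map f hf) ↔ IsClose ε c c' := by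
  simp only [IsClose, mem_map_iff, forall_exists_index, and_imp, forall_apply_eq_imp_iff₂,
    UnbasedLoop.range_map, Set.image_subset_iff, preimage_ball_zero hf h0]
  refine forall_congr' fun i ↦ and_congr ?_ ?_
  · refine forall₂_congr fun v _ ↦ forall_congr' fun _ ↦ ⟨?_, ?_⟩
    · rintro ⟨_, ⟨v', hv', rfl⟩, hd⟩
      exact ⟨v', hv', by rwa [UnbasedLoop.udist_map_map] at hd⟩
    · rintro ⟨v', hv', hd⟩
      exact ⟨_, ⟨v', hv', rfl⟩, by rwa [UnbasedLoop.udist_map_map]⟩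
  · refine forall₂_congr fun v _ ↦ forall_congr' fun _ ↦ ⟨?_, ?_⟩
    · rintro ⟨_, ⟨v', hv', rfl⟩, hd⟩
      exact ⟨v', hv', by rwa [UnbasedLoop.udist_map_map] at hd⟩
    · rintro ⟨v', hv', hd⟩
      exact ⟨_, ⟨v', hv', rfl⟩, by rwa [UnbasedLoop.udist_map_map]⟩

end Normed


/-! ### Measurability of the event `d_CN ≤ ε` for countably generated configurations -/

section Measurability

variable {E : Type*} [NormedAddCommGroup E]
variable {Ω Ω' : Type*}

/-- `d_CN ≤ ε` between two *countably generated* random configurations — `(X ω).F i` is the set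
of the loops `f i k`, `k` ranging over the indices of a countable family whose (measurable)
events `S i k ∋ ω` occur, as for the loop representation of a lattice configuration (`k` = a
combinatorial loop, `S i k` = "`k` is an interface loop of `ω` of type `i`") — unfolds into a
countable Boolean combination of the generating events. [folklore] -/
theorem isClose_iff_of_gen {ι ι' : Type*} {X : Ω → LoopConfig E} {X' : Ω' → LoopConfig E}
    {f : Fin 2 → ι → UnbasedLoop E} {S : Fin 2 → ι → Set Ω}
    (hX : ∀ ω i u, u ∈ (X ω).F i ↔ ∃ k, ω ∈ S i k ∧ f i k = u)
    {f' : Fin 2 → ι' → UnbasedLoop E} {S' : Fin 2 → ι' → Set Ω'}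
    (hX' : ∀ ω i u, u ∈ (X' ω).F i ↔ ∃ k, ω ∈ S' i k ∧ f' i k = u) (ε : ℝ) (ω : Ω) (ω' : Ω') :
    IsClose ε (X ω) (X' ω') ↔ ∀ i : Fin 2,
      (∀ k, ω ∈ S i k → (f i k).range ⊆ Metric.ball (0 : E) (1 / ε) →
        ∃ k', ω' ∈ S' i k' ∧ (f i k).udist (f' i k') ≤ ε) ∧
      (∀ k', ω' ∈ S' i k' → (f' i k').range ⊆ Metric.ball (0 : E) (1 / ε) →
        ∃ k, ω ∈ S i k ∧ (f' i k').udist (f i k) ≤ ε) := by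
  refine forall_congr' fun i ↦ and_congr ?_ ?_
  · constructor
    · intro h k hk hr
      obtain ⟨u', hu', hd⟩ := h (f i k) ((hX ω i _).2 ⟨k, hk, rfl⟩) hr
      obtain ⟨k', hk', rfl⟩ := (hX' ω' i u').1 hu'
      exact ⟨k', hk', hd⟩
    · intro h u hu hr
      obtain ⟨k, hk, rfl⟩ := (hX ω i u).1 hu
      obtain ⟨k', hk', hd⟩ := h k hk hr
      exact ⟨f' i k', (hX' ω' i _).2 ⟨k', hk', rfl⟩, hd⟩
  · constructor
    · intro h k' hk' hr
      obtain ⟨u, hu, hd⟩ := h (f' i k') ((hX' ω' i _).2 ⟨k', hk', rfl⟩) hr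
      obtain ⟨k, hk, rfl⟩ := (hX ω i u).1 hu
      exact ⟨k, hk, hd⟩
    · intro h u' hu' hr
      obtain ⟨k', hk', rfl⟩ := (hX' ω' i u').1 hu'
      obtain ⟨k, hk, hd⟩ := h k' hk' hr
      exact ⟨f i k, (hX ω i _).2 ⟨k, hk, rfl⟩, hd⟩

/-- **Measurability of `{d_CN(X, X') ≤ ε}`** on `Ω × Ω'` for countably generated random
configurations with measurable generating events. [folklore] -/
theorem measurableSet_isClose_of_gen [MeasurableSpace Ω] [MeasurableSpace Ω'] {ι ι' : Type*}
    [Countable ι] [Countable ι'] {X : Ω → LoopConfig E} {X' : Ω' → LoopConfig E}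
    {f : Fin 2 → ι → UnbasedLoop E} {S : Fin 2 → ι → Set Ω} (hS : ∀ i k, MeasurableSet (S i k))
    (hX : ∀ ω i u, u ∈ (X ω).F i ↔ ∃ k, ω ∈ S i k ∧ f i k = u)
    {f' : Fin 2 → ι' → UnbasedLoop E} {S' : Fin 2 → ι' → Set Ω'} (hS' : ∀ i k, MeasurableSet (S' i k))
    (hX' : ∀ ω i u, u ∈ (X' ω).F i ↔ ∃ k, ω ∈ S' i k ∧ f' i k = u) (ε : ℝ) :
    MeasurableSet {p : Ω × Ω' | IsClose ε (X p.1) (X' p.2)} := by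
  simp only [isClose_iff_of_gen hX hX' ε]
  refine measurableSet_setOf.2 (Measurable.forall fun i ↦ Measurable.and ?_ ?_)
  · refine Measurable.forall fun k ↦ Measurable.imp ?_ (Measurable.imp measurable_const ?_)
    · exact measurableSet_setOf.1 (measurable_fst (hS i k))
    · exact Measurable.exists fun k' ↦ Measurable.and (measurableSet_setOf.1 (measurable_snd (hS' i k')))
        measurable_const
  · refine Measurable.forall fun k' ↦ Measurable.imp ?_ (Measurable.imp measurable_const ?_)
    · exact measurableSet_setOf.1 (measurable_snd (hS' i k'))
    · exact Measurable.exists fun k ↦ Measurable.and (measurableSet_setOf.1 (measurable_fst (hS i k)))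
        measurable_const

/-- A pushed-forward countably generated configuration is countably generated by the
pushed-forward loops and the same events. [folklore] -/
theorem gen_map {F : Type*} [NormedAddCommGroup F] {ι : Type*} {X : Ω → LoopConfig E}
    {f : Fin 2 → ι → UnbasedLoop E} {S : Fin 2 → ι → Set Ω}
    (hX : ∀ ω i u, u ∈ (X ω).F i ↔ ∃ k, ω ∈ S i k ∧ f i k = u) (g : C(E, F)) (hg : Isometry g) :
    ∀ ω i u, u ∈ ((X ω).map g hg).F i ↔ ∃ k, ω ∈ S i k ∧ (f i k).map g hg = u := by
  intro ω i u
  simp only [mem_map_iff, hX, exists_exists_and_eq_and]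

/-- Precomposition with a map keeps a random configuration countably generated (by the
pulled-back events). [folklore] -/
theorem gen_comp {ι Ω₀ : Type*} {X : Ω → LoopConfig E} {f : Fin 2 → ι → UnbasedLoop E}
    {S : Fin 2 → ι → Set Ω} (hX : ∀ ω i u, u ∈ (X ω).F i ↔ ∃ k, ω ∈ S i k ∧ f i k = u) (g : Ω₀ → Ω) :
    ∀ ω i u, u ∈ ((X ∘ g) ω).F i ↔ ∃ k, ω ∈ g ⁻¹' S i k ∧ f i k = u :=
  fun ω i u ↦ hX (g ω) i u

end Measurability

/-! ### The coupling distance: trivial bound, diagonal coupling, transport, congruence -/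

section Law

variable {E : Type*} [NormedAddCommGroup E]
variable {Ω Ω' : Type*} [MeasurableSpace Ω] [MeasurableSpace Ω']

/-- `d_CN(φ, φ') ≤ 1` for probability laws: for `ε > 1` the product coupling has
`P[d_CN > ε] ≤ 1 < ε`. [folklore] -/
theorem cnLawEDist_le_one (μ : Measure Ω) [IsProbabilityMeasure μ] (X : Ω → LoopConfig E)
    (μ' : Measure Ω') [IsProbabilityMeasure μ'] (X' : Ω' → LoopConfig E) :
    cnLawEDist μ X μ' X' ≤ 1 := by
  rw [← ENNReal.ofReal_one]
  refine (cnLawEDist_le_iff_forall_lt zero_le_one).2 fun ε hε ↦ ⟨μ.prod μ', ?_, ?_, ?_⟩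
  · rw [Measure.map_fst_prod, measure_univ, one_smul]
  · rw [Measure.map_snd_prod, measure_univ, one_smul]
  · exact prob_le_one.trans_lt (ENNReal.one_lt_ofReal.2 hε)

/-- `d_CN(φ, φ) = 0`: the diagonal coupling has no exceptional set (`isClose_self`). The
measurability hypothesis makes the exceptional event of the pushed-forward coupling computable. [folklore] -/
theorem cnLawEDist_self (μ : Measure Ω) (X : Ω → LoopConfig E)
    (hm : ∀ ε, MeasurableSet {p : Ω × Ω | IsClose ε (X p.1) (X p.2)}) :
    cnLawEDist μ X μ X = 0 := by
  refine le_antisymm (ENNReal.le_of_forall_pos_le_add fun ε hε _ ↦ ?_) bot_le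
  rw [zero_add, ← ENNReal.ofReal_coe_nnreal]
  have hε' : (0 : ℝ) < ε := by exact_mod_cast hε
  have hmeas : Measurable fun ω : Ω ↦ (ω, ω) := measurable_id.prodMk measurable_id
  refine cnLawEDist_le_of_coupling hε' (μ.map fun ω ↦ (ω, ω)) ?_ ?_ ?_
  · rw [Measure.map_map measurable_fst hmeas]; exact Measure.map_id
  · rw [Measure.map_map measurable_snd hmeas]; exact Measure.map_id
  · rw [← Set.compl_setOf, Measure.map_apply hmeas (hm ε).compl]
    have : (fun ω : Ω ↦ (ω, ω)) ⁻¹' {p : Ω × Ω | IsClose (ε : ℝ) (X p.1) (X p.2)}ᶜ = ∅ :=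
      Set.eq_empty_of_forall_notMem fun ω h ↦ h (isClose_self hε'.le (X ω))
    rw [this, measure_empty]
    exact ENNReal.ofReal_pos.2 hε'

/-- **Congruence**: the coupling distance only depends on the exceptional events
`{d_CN(X(ω), X'(ω')) > ε}`; two pairs of random configurations with the same exceptional
events (e.g. differing by reversing members, or by a common isometry fixing `0`) are at the same
distance. [folklore] -/
theorem cnLawEDist_congr {μ : Measure Ω} {μ' : Measure Ω'} {X Y : Ω → LoopConfig E}
    {X' Y' : Ω' → LoopConfig E} (h : ∀ ε ω ω', IsClose ε (X ω) (X' ω') ↔ IsClose ε (Y ω) (Y' ω')) :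
    cnLawEDist μ X μ' X' = cnLawEDist μ Y μ' Y' := by
  simp only [cnLawEDist, h]

/-- **Transport along measurable maps**: a coupling of `μ` and `μ'` pushes forward to a coupling
of `g_* μ` and `g'_* μ'` with the corresponding exceptional event, so
`d_CN((g_*μ, X), (g'_*μ', X')) ≤ d_CN((μ, X ∘ g), (μ', X' ∘ g'))`. (Used with measure-preserving
lattice symmetries `g`.) [folklore] -/
theorem cnLawEDist_map_le {Ω₀ Ω₀' : Type*} [MeasurableSpace Ω₀] [MeasurableSpace Ω₀']
    {g : Ω₀ → Ω} {g' : Ω₀' → Ω'} (hg : Measurable g) (hg' : Measurable g') (μ : Measure Ω₀)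
    (μ' : Measure Ω₀') (X : Ω → LoopConfig E) (X' : Ω' → LoopConfig E)
    (hm : ∀ ε, MeasurableSet {p : Ω × Ω' | IsClose ε (X p.1) (X' p.2)}) :
    cnLawEDist (μ.map g) X (μ'.map g') X' ≤ cnLawEDist μ (X ∘ g) μ' (X' ∘ g') := by
  refine le_iInf fun ε ↦ le_iInf fun hε ↦ le_iInf fun P ↦ le_iInf fun h₁ ↦ le_iInf fun h₂ ↦
    le_iInf fun hP ↦ ?_
  have hgg : Measurable (Prod.map g g') := hg.prodMap hg'
  refine cnLawEDist_le_of_coupling hε (P.map (Prod.map g g')) ?_ ?_ ?_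
  · have e : Prod.fst ∘ Prod.map g g' = g ∘ (Prod.fst : Ω₀ × Ω₀' → Ω₀) := funext fun _ ↦ rfl
    rw [Measure.map_map measurable_fst hgg, e, ← Measure.map_map (μ := P) hg measurable_fst, h₁]
  · have e : Prod.snd ∘ Prod.map g g' = g' ∘ (Prod.snd : Ω₀ × Ω₀' → Ω₀') := funext fun _ ↦ rfl
    rw [Measure.map_map measurable_snd hgg, e, ← Measure.map_map (μ := P) hg' measurable_snd, h₂]
  · rw [← Set.compl_setOf, Measure.map_apply hgg (hm ε).compl]
    exact hP

end Law

/-! ### Gluing couplings: the triangle inequality for the coupling distance -/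

section Gluing

variable {Ω₁ Ω₂ Ω₃ : Type*} [MeasurableSpace Ω₁] [MeasurableSpace Ω₂] [MeasurableSpace Ω₃]

/-- **Gluing lemma** (composition of couplings). Two couplings `P` on `Ω₁ × Ω₂` and `Q` on
`Ω₂ × Ω₃` with the same middle marginal glue to a coupling `T` on `Ω₁ × Ω₃` of the outer
marginals, along the conditional laws given the middle coordinate (disintegration, Mathlib's
`Measure.condKernel`, for standard Borel `Ω₁`, `Ω₃`), and an event `C ⊆ Ω₁ × Ω₃` implied by
the union of events `A ⊆ Ω₁ × Ω₂`, `B ⊆ Ω₂ × Ω₃` through every middle point has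
`T(C) ≤ P(A) + Q(B)`. (Villani, *Optimal transport* (2009), Gluing Lemma, Ch. 1; Dudley 2002,
§11.8.) [folklore] -/
theorem exists_glued_coupling [StandardBorelSpace Ω₁] [Nonempty Ω₁] [StandardBorelSpace Ω₃]
    [Nonempty Ω₃] (P : Measure (Ω₁ × Ω₂)) (Q : Measure (Ω₂ × Ω₃)) [IsFiniteMeasure P]
    [IsFiniteMeasure Q] (h : P.map Prod.snd = Q.map Prod.fst) :
    ∃ T : Measure (Ω₁ × Ω₃), T.map Prod.fst = P.map Prod.fst ∧ T.map Prod.snd = Q.map Prod.snd ∧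
      ∀ {A : Set (Ω₁ × Ω₂)} {B : Set (Ω₂ × Ω₃)} {C : Set (Ω₁ × Ω₃)}, MeasurableSet A →
        MeasurableSet B → MeasurableSet C → (∀ a b c, (a, c) ∈ C → (a, b) ∈ A ∨ (b, c) ∈ B) →
        T C ≤ P A + Q B := by
  -- disintegrate both couplings over the middle coordinate
  set P' : Measure (Ω₂ × Ω₁) := P.map Prod.swap with hP'
  set μ₂ : Measure Ω₂ := Q.fst with hμ₂
  have hP'fst : P'.fst = μ₂ := by
    rw [Measure.fst, hP', Measure.map_map measurable_fst measurable_swap]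
    exact h
  set κ : Kernel Ω₂ Ω₁ := P'.condKernel with hκ
  set η : Kernel Ω₂ Ω₃ := Q.condKernel with hη
  have hPd : μ₂ ⊗ₘ κ = P' := by rw [← hP'fst]; exact Measure.disintegrate P' κ
  have hQd : μ₂ ⊗ₘ η = Q := Measure.disintegrate Q η
  set R : Measure (Ω₂ × (Ω₁ × Ω₃)) := μ₂ ⊗ₘ (κ ×ₖ η) with hR
  -- the two-dimensional marginals of `R`
  have hR12 : R.map (fun p ↦ (p.2.1, p.1)) = P := by
    have e : (fun p : Ω₂ × (Ω₁ × Ω₃) ↦ (p.2.1, p.1)) = Prod.swap ∘ Prod.map id Prod.fst := rfl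
    rw [e, ← Measure.map_map measurable_swap (measurable_id.prodMap measurable_fst), hR,
      ← Measure.compProd_map measurable_fst, ← Kernel.fst_eq, Kernel.fst_prod, hPd, hP',
      Measure.map_map measurable_swap measurable_swap, Prod.swap_swap_eq, Measure.map_id]
  have hR23 : R.map (Prod.map id Prod.snd) = Q := by
    rw [hR, ← Measure.compProd_map measurable_snd, ← Kernel.snd_eq, Kernel.snd_prod, hQd]
  refine ⟨R.snd, ?_, ?_, ?_⟩
  · rw [Measure.snd, Measure.map_map measurable_fst measurable_snd, ← hR12,
      Measure.map_map measurable_fst (measurable_snd.fst.prodMk measurable_fst)]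
    rfl
  · rw [Measure.snd, Measure.map_map measurable_snd measurable_snd, ← hR23,
      Measure.map_map measurable_snd (measurable_id.prodMap measurable_snd)]
    rfl
  · intro A B C hA hB hC hABC
    rw [Measure.snd_apply hC, ← hR12, ← hR23,
      Measure.map_apply (measurable_snd.fst.prodMk measurable_fst) hA,
      Measure.map_apply (measurable_id.prodMap measurable_snd) hB]
    refine (measure_mono fun p hp ↦ ?_).trans (measure_union_le _ _)
    exact hABC p.2.1 p.1 p.2.2 hp

variable {E : Type*} [NormedAddCommGroup E]

/-- **Triangle inequality for DKKMO's coupling distance** (for probability laws, standard Borel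
outer spaces, and a measurable exceptional event for the outer pair):
`d_CN(φ, φ'') ≤ d_CN(φ, φ') + d_CN(φ', φ'')`. For `ε > d_CN(φ, φ')`, `ε' > d_CN(φ', φ'')` with
`ε + ε' ≤ 1`, glue the two couplings (`exists_glued_coupling`); off the union of the two
exceptional events `d_CN ≤ ε + ε'` holds by the restricted triangle inequality `IsClose.trans`;
and every `d_CN` of probability laws is `≤ 1` (`cnLawEDist_le_one`), which covers `ε + ε' > 1`.
This is the coupling surgery of DKKMO's proof of Theorem 1.2 (arXiv:2012.11672v1 §7.1 /
v2 Remark 1.8: "couple `σ_0 ω'` with `ω^α` [...] then couple `σ_{α/2} ω^α` with `ω`"). [folklore] -/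
theorem cnLawEDist_triangle [StandardBorelSpace Ω₁] [Nonempty Ω₁] [StandardBorelSpace Ω₃]
    [Nonempty Ω₃] (μ₁ : Measure Ω₁) (μ₂ : Measure Ω₂) (μ₃ : Measure Ω₃) [IsProbabilityMeasure μ₁]
    [IsProbabilityMeasure μ₂] [IsProbabilityMeasure μ₃] (X₁ : Ω₁ → LoopConfig E)
    (X₂ : Ω₂ → LoopConfig E) (X₃ : Ω₃ → LoopConfig E)
    (hm : ∀ ε, MeasurableSet {p : Ω₁ × Ω₃ | IsClose ε (X₁ p.1) (X₃ p.2)}) :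
    cnLawEDist μ₁ X₁ μ₃ X₃ ≤ cnLawEDist μ₁ X₁ μ₂ X₂ + cnLawEDist μ₂ X₂ μ₃ X₃ := by
  set a := cnLawEDist μ₁ X₁ μ₂ X₂ with ha
  set b := cnLawEDist μ₂ X₂ μ₃ X₃ with hb
  have ha1 : a ≠ ⊤ := ne_top_of_le_ne_top ENNReal.one_ne_top (cnLawEDist_le_one _ _ _ _)
  have hb1 : b ≠ ⊤ := ne_top_of_le_ne_top ENNReal.one_ne_top (cnLawEDist_le_one _ _ _ _)
  rw [← ENNReal.ofReal_toReal ha1, ← ENNReal.ofReal_toReal hb1,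
    ← ENNReal.ofReal_add ENNReal.toReal_nonneg ENNReal.toReal_nonneg]
  refine (cnLawEDist_le_iff_forall_lt (add_nonneg ENNReal.toReal_nonneg ENNReal.toReal_nonneg)).2
    fun ε hε ↦ ?_
  by_cases hε1 : 1 < ε
  · -- trivial coupling
    refine ⟨μ₁.prod μ₃, ?_, ?_, prob_le_one.trans_lt (ENNReal.one_lt_ofReal.2 hε1)⟩
    · rw [Measure.map_fst_prod, measure_univ, one_smul]
    · rw [Measure.map_snd_prod, measure_univ, one_smul]
  · push Not at hε1
    set s := (ε - a.toReal - b.toReal) / 2 with hs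
    have hs0 : 0 < s := by rw [hs]; linarith
    set ε₁ := a.toReal + s with hε₁
    set ε₂ := b.toReal + s with hε₂
    have hε₁0 : 0 < ε₁ := by positivity
    have hε₂0 : 0 < ε₂ := by positivity
    have hsum : ε₁ + ε₂ = ε := by rw [hε₁, hε₂, hs]; ring
    have h1 : a < ENNReal.ofReal ε₁ := by
      rw [← ENNReal.ofReal_toReal ha1]; exact ENNReal.ofReal_lt_ofReal_iff'.2 ⟨by linarith, hε₁0⟩
    have h2 : b < ENNReal.ofReal ε₂ := by
      rw [← ENNReal.ofReal_toReal hb1]; exact ENNReal.ofReal_lt_ofReal_iff'.2 ⟨by linarith, hε₂0⟩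
    obtain ⟨P, hP₁, hP₂, hP⟩ := exists_coupling_of_cnLawEDist_lt h1
    obtain ⟨Q, hQ₁, hQ₂, hQ⟩ := exists_coupling_of_cnLawEDist_lt h2
    haveI : IsProbabilityMeasure P := ⟨by
      rw [← Set.preimage_univ (f := (Prod.fst : Ω₁ × Ω₂ → Ω₁)),
        ← Measure.map_apply measurable_fst MeasurableSet.univ, hP₁, measure_univ]⟩
    haveI : IsProbabilityMeasure Q := ⟨by
      rw [← Set.preimage_univ (f := (Prod.fst : Ω₂ × Ω₃ → Ω₂)),
        ← Measure.map_apply measurable_fst MeasurableSet.univ, hQ₁, measure_univ]⟩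
    obtain ⟨A, hAsub, hA, hPA⟩ := exists_measurable_superset P {p : Ω₁ × Ω₂ | ¬ IsClose ε₁ (X₁ p.1) (X₂ p.2)}
    obtain ⟨B, hBsub, hB, hQB⟩ := exists_measurable_superset Q {p : Ω₂ × Ω₃ | ¬ IsClose ε₂ (X₂ p.1) (X₃ p.2)}
    obtain ⟨T, hT₁, hT₂, hT⟩ := exists_glued_coupling P Q (hP₂.trans hQ₁.symm)
    refine ⟨T, hT₁.trans hP₁, hT₂.trans hQ₂, ?_⟩
    have hC : MeasurableSet {p : Ω₁ × Ω₃ | ¬ IsClose ε (X₁ p.1) (X₃ p.2)} := (hm ε).compl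
    calc T {p : Ω₁ × Ω₃ | ¬ IsClose ε (X₁ p.1) (X₃ p.2)} ≤ P A + Q B := by
          refine hT hA hB hC fun a₀ b₀ c₀ hac ↦ ?_
          by_contra hcon
          push Not at hcon
          refine hac ?_
          rw [← hsum]
          exact IsClose.trans hε₁0 hε₂0 (hsum.le.trans hε1)
            (not_not.1 fun h' ↦ hcon.1 (hAsub h')) (not_not.1 fun h' ↦ hcon.2 (hBsub h'))
      _ < ENNReal.ofReal ε₁ + ENNReal.ofReal ε₂ := by
          rw [hPA, hQB]
          exact ENNReal.add_lt_add hP hQ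
      _ = ENNReal.ofReal ε := by rw [← ENNReal.ofReal_add hε₁0.le hε₂0.le, hsum]

end Gluing

end LoopConfig

end Literature.Probability.RandomPlanarGeometry

end
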